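import Literature.Topology.FourManifolds.BasinConeMap

/-!
# Couples of basin settings: two Morse data on one manifold

Topic `Literature/Topology/FourManifolds` (third file of the *structure conjugacy* of two
one-level Morse data on a handlebody, support of `stmt-SmoothPoincare4-15190`; the two-function
analogue of `BasinPair.lean`).  Everything here is **proved**.

* `BasinSetting.exists_a'_eq_r₀_eq` — a basin setting may be **re-cut**: for every collar level
  `a'' ∈ (0, a']` and chart radius `r ∈ (0, r₀]` there is a basin setting of the same `(g, ξ)`
  with the same minimum and Milnor chart, collar level `a''` and radius `r` (lower the collar
  setting, `CollarSetting.lower`; take a slab flow of the longer slab, Milnor's Thm. 3.4);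
* `BasinCouple g_A g_B ξ_A ξ_B` — **a couple of basin settings**: basin settings `A` of
  `(g_A, ξ_A)` and `B` of `(g_B, ξ_B)` on the same `W` with the same collar level and the same
  chart radius (so the same levels `L`, `hi`, the same `κ`, `rad`, and chart balls of the same
  size); `BasinCouple.swap`; couples exist for any two Morse functions on `(W; ∅, ∂W)` with
  smooth gradient-like fields and unique minima (`BasinCouple.nonempty`).

## References

* J. Milnor, *Lectures on the h-cobordism theorem* (1965), Def. 3.1, proof of Thm. 3.4, Def. 3.9
  (PDF pp. 11–13, 16). [MilnorHCobordism1965]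
-/

open scoped Manifold ContDiff Topology
open Set Function Filter Metric

noncomputable section

namespace Literature.Topology.FourManifolds

open Cobordism FourManifolds.Flow

universe u

variable {n : ℕ} {W : Type u} [TopologicalSpace W] [T2Space W] [SecondCountableTopology W]
  [CompactSpace W] [ChartedSpace (EuclideanHalfSpace (n + 1)) W] [IsManifold (𝓡∂ (n + 1)) ∞ W]

/-! ### Re-cutting a basin setting -/

namespace BasinSetting

variable {g : W → ℝ} {ξ : Π x : W, TangentSpace (𝓡∂ (n + 1)) x}

/-- **A basin setting may be re-cut to any smaller collar level and chart radius**, keeping the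
minimum and the Milnor chart. [cite: MilnorHCobordism1965, proof of Thm. 3.4 (PDF pp. 12–13), Def. 3.9] -/
theorem exists_a'_eq_r₀_eq (B : BasinSetting g ξ) {a'' : ℝ} (h₀ : 0 < a'') (hle : a'' ≤ B.S.a') {r : ℝ}
    (hr : 0 < r) (hrle : r ≤ B.r₀) :
    ∃ B' : BasinSetting g ξ, B'.S.a' = a'' ∧ B'.r₀ = r ∧ B'.p₀ = B.p₀ ∧ B'.φ = B.φ := by
  set S' := B.S.lower a'' h₀ hle with hS'
  have hS'a : S'.a' = a'' := rfl
  have ha₀ : 0 < g B.p₀ / 2 := by linarith [B.apply_p₀_pos]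
  have ha₁ : 1 - pushConst * a'' / 4 < 1 := by
    have := pushConst_pos; nlinarith
  have ha₀₁ : g B.p₀ / 2 < 1 - pushConst * a'' / 4 := by
    have h1 : pushConst * a'' / 4 ≤ a'' / 4 := by
      have := pushConst_le_one; nlinarith
    have h2 : a'' ≤ 1 / 8 := hle.trans B.a'_le
    have h3 : g B.p₀ < 1 - B.S.a' := B.crit_lt B.p₀ B.isMCriticalPt_p₀
    linarith [B.a'_pos]
  obtain ⟨θ, hθ⟩ := B.isMorseFunction.exists_slabFlow B.contMDiff B.isGradientLike ha₀ ha₀₁ ha₁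
  have hrsq : r ^ 2 ≤ B.r₀ ^ 2 := pow_le_pow_left₀ hr.le hrle 2
  refine ⟨⟨B.isMorseFunction, B.contMDiff, B.isGradientLike, S', fun p hp => ?_, B.p₀, ?_,
    B.criticalSetOfIndex_zero, θ, hθ, B.φ, B.φ_mem, B.p₀_mem, B.g_eq, B.ξ_eq, r, hr, ?_, ?_, fun p hp hpp => ?_, ?_⟩,
    rfl, rfl, rfl, rfl⟩
  · rw [hS'a]; exact (B.crit_lt p hp).trans_le (by linarith)
  · rw [hS'a]; exact lt_of_le_of_lt hle B.a'_lt_apply_p₀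
  · exact (closedBall_subset_closedBall hrle).trans B.closedBall_subset
  · exact Subset.trans (fun q hq => by simp only [mem_preimage, mem_Iic] at hq ⊢; linarith) B.sublevel_subset
  · exact lt_of_le_of_lt (by linarith) (B.lt_of_isMCriticalPt p hp hpp)
  · rw [hS'a]; exact lt_of_le_of_lt (by linarith) (B.level_lt.trans_le (by linarith))

end BasinSetting

/-! ### Couples of basin settings -/

/-- **A couple of basin settings** for two Morse data `(g_A, ξ_A)`, `(g_B, ξ_B)` on
`(W; ∅, ∂W)`: two `BasinSetting`s with the same collar level and the same chart radius. [cite: MilnorHCobordism1965, Def. 3.1, Def. 3.9 (PDF pp. 11, 16)] -/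
structure BasinCouple (gA gB : W → ℝ) (ξA ξB : Π x : W, TangentSpace (𝓡∂ (n + 1)) x) where
  /-- the basin setting of `(g_A, ξ_A)` -/
  A : BasinSetting gA ξA
  /-- the basin setting of `(g_B, ξ_B)` -/
  B : BasinSetting gB ξB
  /-- same collar level -/
  a'_eq : B.S.a' = A.S.a'
  /-- same chart radius -/
  r₀_eq : B.r₀ = A.r₀

namespace BasinCouple

variable {gA gB : W → ℝ} {ξA ξB : Π x : W, TangentSpace (𝓡∂ (n + 1)) x}

/-- **Couples of basin settings exist** for two Morse functions on `(W; ∅, ∂W)` with smooth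
gradient-like fields and unique critical points of index `0`. [cite: MilnorHCobordism1965, Def. 3.1, proof of Thm. 3.4 (PDF pp. 11–13)] -/
theorem nonempty (hgA : (Cobordism.ofBoundary n W).IsMorseFunction gA) (hgB : (Cobordism.ofBoundary n W).IsMorseFunction gB)
    (hξAs : ContMDiff (𝓡∂ (n + 1)) (𝓡∂ (n + 1)).tangent ∞ fun x => (⟨x, ξA x⟩ : TangentBundle (𝓡∂ (n + 1)) W))
    (hξBs : ContMDiff (𝓡∂ (n + 1)) (𝓡∂ (n + 1)).tangent ∞ fun x => (⟨x, ξB x⟩ : TangentBundle (𝓡∂ (n + 1)) W))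
    (hξA : IsGradientLike (𝓡∂ (n + 1)) gA ξA) (hξB : IsGradientLike (𝓡∂ (n + 1)) gB ξB)
    {pA : W} (hpA : criticalSetOfIndex (𝓡∂ (n + 1)) gA 0 = {pA})
    {pB : W} (hpB : criticalSetOfIndex (𝓡∂ (n + 1)) gB 0 = {pB}) : Nonempty (BasinCouple gA gB ξA ξB) := by
  obtain ⟨A₀⟩ := BasinSetting.nonempty hgA hξAs hξA hpA
  obtain ⟨B₀⟩ := BasinSetting.nonempty hgB hξBs hξB hpB
  obtain ⟨A, hAa, hAr, -, -⟩ := A₀.exists_a'_eq_r₀_eq (lt_min A₀.a'_pos B₀.a'_pos) (min_le_left _ _)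
    (lt_min A₀.r₀_pos B₀.r₀_pos) (min_le_left _ _)
  obtain ⟨B, hBa, hBr, -, -⟩ := B₀.exists_a'_eq_r₀_eq (lt_min A₀.a'_pos B₀.a'_pos) (min_le_right _ _)
    (lt_min A₀.r₀_pos B₀.r₀_pos) (min_le_right _ _)
  exact ⟨⟨A, B, by rw [hAa, hBa], by rw [hAr, hBr]⟩⟩

variable (C : BasinCouple gA gB ξA ξB)

/-- **The swapped couple.** [folklore] -/
def swap : BasinCouple gB gA ξB ξA := ⟨C.B, C.A, C.a'_eq.symm, C.r₀_eq.symm⟩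

/-- `swap.A = B`. [folklore] -/
@[simp] theorem swap_A : C.swap.A = C.B := rfl

/-- `swap.B = A`. [folklore] -/
@[simp] theorem swap_B : C.swap.B = C.A := rfl

/-- `swap.swap = C`. [folklore] -/
@[simp] theorem swap_swap : C.swap.swap = C := rfl

/-- Same `κ`. [folklore] -/
theorem κ_eq : C.B.κ = C.A.κ := by unfold BasinSetting.κ; rw [C.a'_eq]

/-- **Same level `L`.** [folklore] -/
theorem L_eq : C.B.L = C.A.L := by unfold BasinSetting.L; rw [C.κ_eq]

/-- **Same level `hi`.** [folklore] -/
theorem hi_eq : C.B.hi = C.A.hi := by unfold BasinSetting.hi; rw [C.κ_eq]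

/-- Same `mid`. [folklore] -/
theorem mid_eq : C.B.mid = C.A.mid := by unfold BasinSetting.mid; rw [C.L_eq, C.hi_eq]

/-- **Same radius `rad`** of the small spheres. [folklore] -/
theorem rad_eq : C.B.rad = C.A.rad := by unfold BasinSetting.rad; rw [C.r₀_eq]

/-- The levels `sph` differ by the difference of the minimum values. [folklore] -/
theorem sph_eq : C.B.sph = C.A.sph + (gB C.B.p₀ - gA C.A.p₀) := by unfold BasinSetting.sph; rw [C.r₀_eq]; ring

/-- The levels `sphR` differ by the difference of the minimum values. [folklore] -/
theorem sphR_eq : C.B.sphR = C.A.sphR + (gB C.B.p₀ - gA C.A.p₀) := by unfold BasinSetting.sphR; rw [C.rad_eq]; ring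

/-- The levels `sphR'` differ by the difference of the minimum values. [folklore] -/
theorem sphR'_eq : C.B.sphR' = C.A.sphR' + (gB C.B.p₀ - gA C.A.p₀) := by unfold BasinSetting.sphR'; rw [C.rad_eq]; ring

variable {C}

/-- **The bottom shift** `ℓ ↦ ℓ + (g_B p₀' - g_A p₀)` carries the levels `(g_A p₀, sph_A)` of
the chart ball of `A` onto those of `B`. [folklore] -/
theorem add_mem_Ioo_sph_iff {ℓ : ℝ} :
    ℓ + (gB C.B.p₀ - gA C.A.p₀) ∈ Ioo (gB C.B.p₀) C.B.sph ↔ ℓ ∈ Ioo (gA C.A.p₀) C.A.sph := by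
  rw [C.sph_eq]; constructor <;> rintro ⟨h1, h2⟩ <;> constructor <;> linarith

/-- **The cone map of a couple with the bottom shift is an exact cone in the charts**: for
`0 < ‖w‖ < r₀` and `T` preserving the small sphere,
`coneMap (ofChart_A w) = ofChart_B ((‖w‖ / rad) • T ((rad / ‖w‖) • w))`. [cite: MilnorHCobordism1965, Def. 3.1 (2), proof of Thm. 3.12] -/
theorem coneMap_ofChart_of_shift {T : EuclideanSpace ℝ (Fin (n + 1)) → EuclideanSpace ℝ (Fin (n + 1))} {lam : ℝ → ℝ}
    {w : EuclideanSpace ℝ (Fin (n + 1))} (hw0 : w ≠ 0) (hw : ‖w‖ < C.A.r₀)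
    (hT : ‖T ((C.A.rad / ‖w‖) • w)‖ = C.A.rad)
    (hlam : lam (gA C.A.p₀ + ‖w‖ ^ 2) = gA C.A.p₀ + ‖w‖ ^ 2 + (gB C.B.p₀ - gA C.A.p₀)) :
    C.A.coneMap C.B T lam (C.A.ofChart w) = C.B.ofChart ((‖w‖ / C.A.rad) • T ((C.A.rad / ‖w‖) • w)) := by
  have hwn : 0 < ‖w‖ := norm_pos_iff.2 hw0
  have hmem : gA C.A.p₀ + ‖w‖ ^ 2 ∈ Ioo (gA C.A.p₀) C.A.sph := by
    refine ⟨by nlinarith [mul_pos hwn hwn], ?_⟩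
    unfold BasinSetting.sph; gcongr
  have hℓ : lam (gA C.A.p₀ + ‖w‖ ^ 2) ∈ Ioo (gB C.B.p₀) C.B.sph := by rw [hlam]; exact add_mem_Ioo_sph_iff.2 hmem
  rw [C.A.coneMap_ofChart hw0 hw (by rw [hT, C.rad_eq]) hℓ, hlam]
  congr 1
  have h1 : gA C.A.p₀ + ‖w‖ ^ 2 + (gB C.B.p₀ - gA C.A.p₀) - gB C.B.p₀ = ‖w‖ ^ 2 := by ring
  rw [h1, Real.sqrt_sq hwn.le, C.rad_eq]

end BasinCouple

end Literature.Topology.FourManifolds
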